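import Literature.NumberTheory.LFunctions.FractionalPartAutocorrelation
import Summits.RiemannHypothesis.RiemannHypothesis.Theorems.NymanBeurlingFractSqIntegral
import HarnessLib

/-!
# RiemannHypothesis / Nyman–Beurling — the Gram matrix of the DATA rung IS the BBLS autocorrelation: `G_{ab} = A(a/b)/a`;
BBLS Prop. 87 `A(1) = log 2π − γ` DISCHARGED; the full Gram matrix in closed form modulo Vasyunin's formula (RH-FREE)

Column LI/NB of the RH ladder, rung L-P(P2) «structure of the NB minimiser», PROOF-OF-DATA for cell `pub/rh-li`.
Dictionary between the tree's Gram entries `nbGram j k = ∫_{(0,∞)} ρ_{j+1} ρ_{k+1}` (what lineages R / A / C2 of DATA.md §L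
tabulate) and the Literature object `Literature.NumberTheory.LFunctions.fractAutocorr` (Báez-Duarte–Balazard–Landreau–Saias,
arXiv:math/0306251 §9):

* `nbGram_eq_fractAutocorr`: `G_{j+1,k+1} = A((j+1)/(k+1))/(j+1)`;
* `bbls2003_prop87_holds : BBLS2003_prop87` — the named fact `A(1) = log 2π − γ` (Prop. 87) is DISCHARGED by the kernel
  theorem `nbGram_zero_zero` (`NymanBeurlingFractSqIntegral.lean`: Farey cells + Stirling);
* `nbGram_eq_vasyunin_of` (CONDITIONAL on the named fact `BBLS2003_prop89` = Vasyunin's formula, Prop. 89): every Gram entry in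
  the closed form the lineages implement, `G_{ab} = [ (1−λ)/2·log λ + (λ+1)/2·(log 2π − γ) − π/(2q)(V(p,q)+V(q,p)) ]/a`,
  `λ = a/b = p/q` in lowest terms.

RH-FREE [rh-li-eng-3]: changes of variables and bookkeeping; nothing here bears on the truth of RH.
-/

noncomputable section

-- D-0017: `Summit.<S>.<S>.…` is the designed namespace of a single-problem summit.
set_option linter.dupNamespace false

open MeasureTheory Set Finset

namespace Summit.RiemannHypothesis.RiemannHypothesis.Theorems.NbTheory

open Literature.NumberTheory.LFunctions Literature.NumberTheory.LFunctions.BaezDuarteOnlyIf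

/-- **`G_{j+1,k+1} = A((j+1)/(k+1))/(j+1)` (RH-FREE):** the Gram entries of the DATA rung are values of the BBLS
multiplicative autocorrelation of the fractional part. -/
theorem nbGram_eq_fractAutocorr (j k : ℕ) :
    nbGram j k = fractAutocorr (((j : ℝ) + 1) / ((k : ℝ) + 1)) / ((j : ℝ) + 1) := by
  unfold nbGram nbRho
  exact integral_Ioi_fract_mul_fract_eq_fractAutocorr ((k : ℝ) + 1) (by positivity)

/-- `A(1) = G_{11}`. -/
theorem fractAutocorr_one_eq_nbGram : fractAutocorr 1 = nbGram 0 0 := by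
  rw [nbGram_eq_fractAutocorr 0 0]
  norm_num

/-- **BBLS Prop. 87 DISCHARGED (RH-FREE): `A(1) = ∫_0^∞ {t}² dt/t² = log 2π − γ`** — from the kernel theorem
`nbGram_zero_zero` (the classical integral `∫_{(0,1]} {1/x}² dx = log 2π − γ − 1` by Farey cells and Stirling). -/
theorem bbls2003_prop87_holds : BBLS2003_prop87 := by
  unfold BBLS2003_prop87
  rw [fractAutocorr_one_eq_nbGram, nbGram_zero_zero]

namespace GramAutocorr

/-- Reduction to lowest terms: with `g = gcd(a,b)`, `a, b ≥ 1`, the reduced numerator and denominator are positive, coprime,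
and have the same ratio. -/
lemma ratio_eq_reduced (a b : ℕ) (ha : 0 < a) (hb : 0 < b) :
    0 < a / Nat.gcd a b ∧ 0 < b / Nat.gcd a b ∧ Nat.Coprime (a / Nat.gcd a b) (b / Nat.gcd a b) ∧
      (a : ℝ) / b = ((a / Nat.gcd a b : ℕ) : ℝ) / ((b / Nat.gcd a b : ℕ) : ℝ) := by
  have hg : 0 < Nat.gcd a b := Nat.gcd_pos_of_pos_left b ha
  have hda : Nat.gcd a b ∣ a := Nat.gcd_dvd_left a b
  have hdb : Nat.gcd a b ∣ b := Nat.gcd_dvd_right a b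
  refine ⟨Nat.div_pos (Nat.le_of_dvd ha hda) hg, Nat.div_pos (Nat.le_of_dvd hb hdb) hg,
    Nat.coprime_div_gcd_div_gcd hg, ?_⟩
  rw [Nat.cast_div hda (by exact_mod_cast hg.ne'), Nat.cast_div hdb (by exact_mod_cast hg.ne')]
  have hg' : ((Nat.gcd a b : ℕ) : ℝ) ≠ 0 := by exact_mod_cast hg.ne'
  have hb' : (b : ℝ) ≠ 0 := by exact_mod_cast hb.ne'
  field_simp

end GramAutocorr

open GramAutocorr

/-- **The Gram matrix in closed form, CONDITIONAL on Vasyunin's formula (named fact `BBLS2003_prop89`; RH-FREE):**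
for `a = j+1`, `b = k+1`, `λ = a/b = p/q` in lowest terms,
`G_{ab} = [ (1−λ)/2·log λ + (λ+1)/2·(log 2π − γ) − π/(2q)·(V(p,q) + V(q,p)) ] / a`
— the formula lineages A / C2 (Arb / float Vasyunin sums) and R (exact integer limbs) of DATA.md §L implement. -/
theorem nbGram_eq_vasyunin_of (h : BBLS2003_prop89) (j k : ℕ) :
    nbGram j k =
      ((1 - ((j : ℝ) + 1) / ((k : ℝ) + 1)) / 2 * Real.log (((j : ℝ) + 1) / ((k : ℝ) + 1))
        + (((j : ℝ) + 1) / ((k : ℝ) + 1) + 1) / 2 * (Real.log (2 * Real.pi) - Real.eulerMascheroniConstant)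
        - Real.pi / (2 * (((k + 1) / Nat.gcd (j + 1) (k + 1) : ℕ) : ℝ)) *
          (vasyuninCotSum (((j + 1) / Nat.gcd (j + 1) (k + 1) : ℕ) : ℤ) ((k + 1) / Nat.gcd (j + 1) (k + 1))
            + vasyuninCotSum (((k + 1) / Nat.gcd (j + 1) (k + 1) : ℕ) : ℤ) ((j + 1) / Nat.gcd (j + 1) (k + 1))))
        / ((j : ℝ) + 1) := by
  obtain ⟨hp, hq, hcop, hratio⟩ := ratio_eq_reduced (j + 1) (k + 1) (Nat.succ_pos j) (Nat.succ_pos k)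
  have hA := h _ _ hp hq hcop
  rw [nbGram_eq_fractAutocorr]
  push_cast at hratio
  rw [hratio, hA, ← hratio]

end Summit.RiemannHypothesis.RiemannHypothesis.Theorems.NbTheory

end
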